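import Literature.Computability.QuantumComplexity.HybridArgumentSets
import Literature.Computability.QuantumComplexity.OracleCircuitLocality
import Literature.Computability.QuantumComplexity.FortnowRogersWorlds
import HarnessLib

/-!
# Counting the witnesses a code can notice: the BBBV hybrid bound summed over a family of oracles

Topic `Literature/Computability/QuantumComplexity`. The quantitative heart of the diagonalization
of `FortnowRogersOracle.lean` (an oracle `C` with `BQP^C ⊆ P^C ≠ UP^C ∩ coUP^C`, Fortnow–Rogers
1999, Thm. 4.2). Setting: a reference oracle `W` and a family of oracles `A w`, one for each
candidate witness `w ∈ Cand`; for a string `s`, `flips W A Cand s` is the number of candidates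
`w` for which the membership of `s` differs between `A w` and `W`. For a code string
`s = ccode x m C` (`FortnowRogersWorlds.lean`) valued canonically in `W` (in iff its circuit accepts with
probability `≥ 1/2` relative to `W`) and with the promise gap in every `A w` (in iff the
probability relative to `A w` is `≥ 2/3`, or `> 1/3` while `s ∈ W`):

* `flips_ccode_le` — **`flips s ≤ 144 T² M`**, `T` the number of oracle gates of `C`, whenever
  every string the circuit can query (length `<` number of wires) is flipped by at most `M`
  candidates. Proof: a flip forces `|P_{A w} − P_W| ≥ 1/6`; by the BBBV hybrid bound
  (`l2Norm_toMatrix_sub_le`, `abs_acceptProb_sub_le`, Cauchy–Schwarz `sum_map_two_mul_sqrt_le`,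
  all proved in `HybridArgument.lean`) the total query magnitude, in the `W`-run, of the set
  `A w △ W` is then `≥ 1/(144 T)`; summing over `w` and exchanging the sums, each queried string
  `u` is charged `flips u ≤ M` times its query magnitude, and the total query magnitude is `≤ T`
  (`sum_sum_queryWeights_le`) — Bennett–Bernstein–Brassard–Vazirani 1997, Thm. 3.3 / Cor. 3.4,
  in the form Fortnow–Rogers use as their Thm. 4.3;
* `flips_le_pow` — if every string flipped by two candidates or more is a code of length `> θ`
  so valued, then **every string of length `< 2ʲ` is flipped by at most `(144 · 4ʲ)ʲ`
  candidates** (induction on `j`: a code only queries strings of less than half its length,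
  `two_mul_wires_add_le`), a quasi-polynomial bound;
* bookkeeping: `queryWeights_eq_queryWeights_filter` (the query magnitudes of a set are those of
  its finite part below the number of wires), whence `sum_queryWeights_eq_sum` from the tree's
  additivity over finite sets (`sum_queryWeights_coe_finset`, `HybridArgumentSets.lean`);
  `exists_forall_iff_of_sum_flips_lt` (if `∑_{u ∈ Q} flips u < |Cand|`, some candidate is noticed
  by no string of `Q`).

## References

* [BennettBernsteinBrassardVazirani1997] C. H. Bennett, E. Bernstein, G. Brassard, U. Vazirani,
  *Strengths and weaknesses of quantum computing*, SIAM J. Comput. 26 (1997) 1510–1523, Thm. 3.3,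
  Cor. 3.4 (arXiv:quant-ph/9701001, pp. 7–8).
* [FortnowRogers1999JCSS] L. Fortnow, J. Rogers, *Complexity limitations on quantum computation*,
  JCSS 59 (1999) 240–252 = arXiv:cs/9811023, Thm. 4.3 and the proof of Thm. 4.2 (pp. 7–8).
-/

noncomputable section

namespace Literature.Computability.QuantumComplexity

open _root_.Computability Complexity Cryptography Matrix

namespace FRO

/-! ### Query magnitude of a set of strings as a sum over its strings -/

section QueryWeightSums

variable {G : QGateSet} {N k : ℕ}

/-- The query string of a basis state at an oracle gate on `N` wires has length `< N`. [folklore] -/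
theorem length_queryOf_lt (e : Fin (k + 1) ↪ Fin N) (y : QReg N) : (queryOf e y).length < N := by
  have hk : k + 1 ≤ N := by simpa using Fintype.card_le_of_embedding e
  have : (queryOf e y).length = k := by simp [queryOf]
  omega

open scoped Classical in
/-- The query magnitude of a set of strings is that of its finite part below the number of wires
(longer strings are never queried, `length_queryOf_lt`). [cite: BennettBernsteinBrassardVazirani1997, Def. 3.2] -/
theorem queryWeight_eq_queryWeight_filter (D : Set (List Bool)) (e : Fin (k + 1) ↪ Fin N) (ψ : QReg N → ℂ) :
    queryWeight D e ψ = queryWeight (↑((shortStrings N).filter (· ∈ D)) : Set (List Bool)) e ψ := by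
  unfold queryWeight
  refine Finset.sum_congr rfl fun y _ => ?_
  have h : queryOf e y ∈ D ↔ queryOf e y ∈ (↑((shortStrings N).filter (· ∈ D)) : Set (List Bool)) := by
    simp [mem_shortStrings, length_queryOf_lt e y]
  by_cases hy : queryOf e y ∈ D
  · rw [if_pos hy, if_pos (h.1 hy)]
  · rw [if_neg hy, if_neg fun h' => hy (h.2 h')]

open scoped Classical in
/-- The same along a run: the query magnitudes of a set are those of its finite part below the
number of wires. [cite: BennettBernsteinBrassardVazirani1997, Def. 3.2] -/
theorem queryWeights_eq_queryWeights_filter (X : Language Bool) (D : Set (List Bool)) :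
    ∀ (gs : List (QGate G N)) (ψ : QReg N → ℂ),
      queryWeights X D gs ψ = queryWeights X (↑((shortStrings N).filter (· ∈ D)) : Set (List Bool)) gs ψ
  | [], _ => rfl
  | g :: gs, ψ => by
    simp only [queryWeights, queryWeights_eq_queryWeights_filter X D gs]
    cases g with
    | gate g e => rfl
    | oracle k e => simp only [QGate.queryWeights, queryWeight_eq_queryWeight_filter D e ψ]

open scoped Classical in
/-- The query magnitudes along a run, summed: the total query magnitude of a set `D` is the sum
over the strings `u ∈ D` of length `< N` of the total query magnitude of `u` (from the tree's
additivity over finite sets, `sum_queryWeights_coe_finset`). [cite: BennettBernsteinBrassardVazirani1997, Def. 3.2] -/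
theorem sum_queryWeights_eq_sum (X : Language Bool) (D : Set (List Bool))
    (gs : List (QGate G N)) (ψ : QReg N → ℂ) :
    (queryWeights X D gs ψ).sum =
      ∑ u ∈ (shortStrings N).filter (· ∈ D), (queryWeights X ({u} : Set (List Bool)) gs ψ).sum := by
  rw [queryWeights_eq_queryWeights_filter, sum_queryWeights_coe_finset]

end QueryWeightSums

/-! ### The number of candidates noticing a string -/

section Flips

variable (W : Set (List Bool)) (A : List Bool → Set (List Bool)) (Cand : Finset (List Bool))

/-- The set of strings on which the oracle `A w` differs from the reference oracle `W`
(extensionally Mathlib's symmetric difference `A w ∆ W`, kept in the `¬ (· ↔ ·)` shape of the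
hypothesis of `l2Norm_toMatrix_sub_le`). [folklore] -/
def Dif (w : List Bool) : Set (List Bool) :=
  {u | ¬ (u ∈ A w ↔ u ∈ W)}

/-- Outside `Dif W A w` the two oracles agree. [folklore] -/
theorem iff_of_not_mem_Dif {w u : List Bool} (h : u ∉ Dif W A w) : u ∈ W ↔ u ∈ A w := by
  simp only [Dif, Set.mem_setOf_eq, not_not] at h
  exact h.symm

open scoped Classical in
/-- **`flips W A Cand s`**: the number of candidates `w ∈ Cand` for which the membership of `s`
in `A w` differs from its membership in `W` (the candidates "noticed" by `s`). [folklore] -/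
def flips (s : List Bool) : ℕ :=
  (Cand.filter fun w => ¬ (s ∈ A w ↔ s ∈ W)).card

/-- A string on which every `A w` agrees with `W` is flipped by no candidate. [folklore] -/
theorem flips_eq_zero_of {s : List Bool} (h : ∀ w ∈ Cand, (s ∈ A w ↔ s ∈ W)) : flips W A Cand s = 0 := by
  classical
  unfold flips
  rw [Finset.card_eq_zero, Finset.filter_eq_empty_iff]
  exact fun w hw hn => hn (h w hw)

/-- A string on which at most one `A w` differs from `W` is flipped by at most one candidate. [folklore] -/
theorem flips_le_one_of {s : List Bool}
    (h : ∀ w ∈ Cand, ∀ w' ∈ Cand, ¬ (s ∈ A w ↔ s ∈ W) → ¬ (s ∈ A w' ↔ s ∈ W) → w = w') :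
    flips W A Cand s ≤ 1 := by
  classical
  unfold flips
  exact Finset.card_le_one.2 fun w hw w' hw' =>
    h w (Finset.mem_filter.1 hw).1 w' (Finset.mem_filter.1 hw').1 (Finset.mem_filter.1 hw).2
      (Finset.mem_filter.1 hw').2

/-- **Pigeonhole**: if the strings of `Q` flip fewer than `|Cand|` candidates in total, some
candidate is noticed by no string of `Q`. [folklore] -/
theorem exists_forall_iff_of_sum_flips_lt (Q : Finset (List Bool))
    (h : ∑ u ∈ Q, flips W A Cand u < Cand.card) : ∃ w ∈ Cand, ∀ u ∈ Q, (u ∈ A w ↔ u ∈ W) := by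
  classical
  by_contra hne
  have hne' : ∀ w ∈ Cand, ∃ u ∈ Q, ¬ (u ∈ A w ↔ u ∈ W) := by
    intro w hw
    by_contra h
    refine hne ⟨w, hw, fun u hu => ?_⟩
    by_contra h'
    exact h ⟨u, hu, h'⟩
  have hsub : Cand ⊆ Q.biUnion fun u => Cand.filter fun w => ¬ (u ∈ A w ↔ u ∈ W) := by
    intro w hw
    obtain ⟨u, hu, hn⟩ := hne' w hw
    exact Finset.mem_biUnion.2 ⟨u, hu, Finset.mem_filter.2 ⟨hw, hn⟩⟩
  have := (Finset.card_le_card hsub).trans Finset.card_biUnion_le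
  exact absurd h (not_lt.2 this)

/-! ### The hybrid bound summed over the candidates -/

/-- **A code valued canonically in `W` and with the promise gap in the `A w` is flipped by at
most `144 T² M` candidates**, `T` its number of oracle gates, if every string its circuit can
query is flipped by at most `M` candidates (BBBV: a flip needs total query magnitude `≥ 1/(144 T)`
on `A w △ W` in the `W`-run; the total query magnitude of all strings is `≤ T`).
[cite: BennettBernsteinBrassardVazirani1997, Thm. 3.3 and Cor. 3.4] [cite: FortnowRogers1999JCSS, Thm. 4.3 (arXiv numbering)] -/
theorem flips_ccode_le (x : List Bool) (m : ℕ) (C : QCircuit cliffordT (x.length + m))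
    (hW : ccode x m C ∈ W ↔ (1 / 2 : ℝ) ≤ C.acceptProb W x.get)
    (hA : ∀ w ∈ Cand, (ccode x m C ∈ A w ↔
      (2 / 3 : ℝ) ≤ C.acceptProb (A w) x.get ∨ ((1 / 3 : ℝ) < C.acceptProb (A w) x.get ∧ ccode x m C ∈ W)))
    {M : ℕ} (hM : ∀ u : List Bool, u.length < x.length + m → flips W A Cand u ≤ M) :
    flips W A Cand (ccode x m C) ≤ 144 * C.oracleQueries ^ 2 * M := by
  classical
  have hG := cliffordT_isUnitary_holds
  obtain ⟨gs⟩ := C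
  set s := ccode x m (⟨gs⟩ : QCircuit cliffordT (x.length + m)) with hs
  set ψ : QReg (x.length + m) → ℂ := basisState (padInput x.get m) with hψdef
  have hψ : normSq ψ = 1 := normSq_basisState _
  set T : ℕ := (⟨gs⟩ : QCircuit cliffordT (x.length + m)).oracleQueries with hT
  set L : List Bool → List ℝ := fun w => queryWeights W (Dif W A w) gs ψ with hL
  have hLnn : ∀ w, 0 ≤ (L w).sum := fun w => List.sum_nonneg (queryWeights_nonneg W _ gs ψ)
  -- Step A: a flipped candidate carries total query magnitude `≥ 1/(144 T)` on `A w △ W`.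
  have stepA : ∀ w ∈ Cand, ¬ (s ∈ A w ↔ s ∈ W) → (1 : ℝ) / 144 ≤ T * (L w).sum := by
    intro w hw hflip
    set PW := (⟨gs⟩ : QCircuit cliffordT (x.length + m)).acceptProb W x.get with hPW
    set PA := (⟨gs⟩ : QCircuit cliffordT (x.length + m)).acceptProb (A w) x.get with hPA
    -- the gap
    have hgap : (1 : ℝ) / 6 ≤ |PA - PW| := by
      by_cases hsW : s ∈ W
      · have h1 : (1 / 2 : ℝ) ≤ PW := hW.1 hsW
        have hsA : s ∉ A w := fun h => hflip ⟨fun _ => hsW, fun _ => h⟩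
        rw [hA w hw] at hsA
        have h2 : PA ≤ 1 / 3 := by
          by_contra h
          exact hsA (Or.inr ⟨not_le.1 h, hsW⟩)
        rw [abs_sub_comm]
        exact le_trans (by linarith) (le_abs_self _)
      · have h1 : PW < 1 / 2 := by
          by_contra h
          exact hsW (hW.2 (not_lt.1 h))
        have hsA : s ∈ A w := by
          by_contra h
          exact hflip ⟨fun h' => absurd h' h, fun h' => absurd h' hsW⟩
        rw [hA w hw] at hsA
        have h2 : (2 / 3 : ℝ) ≤ PA := by
          rcases hsA with h | ⟨-, h⟩
          · exact h
          · exact absurd h hsW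
        exact le_trans (by linarith) (le_abs_self _)
    -- BBBV
    have hAB : ∀ u, u ∉ Dif W A w → (u ∈ W ↔ u ∈ A w) := fun u hu => iff_of_not_mem_Dif W A hu
    have hbbbv : |PA - PW| ≤ ((L w).map fun q => 2 * Real.sqrt q).sum :=
      ((⟨gs⟩ : QCircuit cliffordT (x.length + m)).abs_acceptProb_sub_le hG W (A w) x.get).trans
        (l2Norm_toMatrix_sub_le hG hAB gs ψ)
    have hcs := sum_map_two_mul_sqrt_le (L w) (queryWeights_nonneg W _ gs ψ)
    rw [hL, length_queryWeights] at hcs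
    have h1 : (1 : ℝ) / 6 ≤ 2 * Real.sqrt (T * (L w).sum) := hgap.trans (hbbbv.trans hcs)
    have h3 : 0 ≤ (T : ℝ) * (L w).sum := mul_nonneg (Nat.cast_nonneg _) (hLnn w)
    nlinarith [Real.sq_sqrt h3, Real.sqrt_nonneg ((T : ℝ) * (L w).sum)]
  -- Step B: sum over the flipped candidates.
  have stepB : ((Cand.filter fun w => ¬ (s ∈ A w ↔ s ∈ W)).card : ℝ) * (1 / 144) ≤
      T * ∑ w ∈ Cand, (L w).sum := by
    rw [← nsmul_eq_mul, ← Finset.sum_const, Finset.mul_sum]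
    calc ∑ w ∈ Cand.filter (fun w => ¬ (s ∈ A w ↔ s ∈ W)), (1 : ℝ) / 144
        ≤ ∑ w ∈ Cand.filter (fun w => ¬ (s ∈ A w ↔ s ∈ W)), (T : ℝ) * (L w).sum :=
          Finset.sum_le_sum fun w hw => stepA w (Finset.mem_filter.1 hw).1 (Finset.mem_filter.1 hw).2
      _ ≤ ∑ w ∈ Cand, (T : ℝ) * (L w).sum :=
          Finset.sum_le_sum_of_subset_of_nonneg (Finset.filter_subset _ _) fun w _ _ =>
            mul_nonneg (Nat.cast_nonneg _) (hLnn w)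
  -- Step C: exchange the sums; each queried string `u` is charged `flips u ≤ M` times.
  set Q : List Bool → ℝ := fun u => (queryWeights W ({u} : Set (List Bool)) gs ψ).sum with hQ
  have hQnn : ∀ u, 0 ≤ Q u := fun u => List.sum_nonneg (queryWeights_nonneg W _ gs ψ)
  have stepC : ∑ w ∈ Cand, (L w).sum ≤ M * T := by
    set S := shortStrings (x.length + m) with hS
    have hrw : ∀ w, (L w).sum = ∑ u ∈ S.filter (· ∈ Dif W A w), Q u := fun w =>
      sum_queryWeights_eq_sum W (Dif W A w) gs ψ
    have hcomm : ∑ w ∈ Cand, ∑ u ∈ S.filter (· ∈ Dif W A w), Q u =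
        ∑ u ∈ S, ∑ w ∈ Cand.filter (fun w => u ∈ Dif W A w), Q u :=
      Finset.sum_comm' fun w u => by simp only [Finset.mem_filter]; tauto
    have hflips : ∀ u, (Cand.filter fun w => u ∈ Dif W A w).card = flips W A Cand u := fun u => by
      unfold flips
      congr 1
      ext w
      simp [Dif]
    calc ∑ w ∈ Cand, (L w).sum = ∑ w ∈ Cand, ∑ u ∈ S.filter (· ∈ Dif W A w), Q u :=
          Finset.sum_congr rfl fun w _ => hrw w
      _ = ∑ u ∈ S, ∑ w ∈ Cand.filter (fun w => u ∈ Dif W A w), Q u := hcomm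
      _ = ∑ u ∈ S, (flips W A Cand u : ℝ) * Q u :=
          Finset.sum_congr rfl fun u _ => by rw [Finset.sum_const, nsmul_eq_mul, hflips]
      _ ≤ ∑ u ∈ S, (M : ℝ) * Q u :=
          Finset.sum_le_sum fun u hu =>
            mul_le_mul_of_nonneg_right (by exact_mod_cast hM u (mem_shortStrings.1 hu)) (hQnn u)
      _ = M * ∑ u ∈ S, Q u := by rw [Finset.mul_sum]
      _ ≤ M * (T * normSq ψ) :=
          mul_le_mul_of_nonneg_left (sum_sum_queryWeights_le hG W S gs ψ) (Nat.cast_nonneg _)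
      _ = M * T := by rw [hψ, mul_one]
  -- conclusion
  have hfin : ((Cand.filter fun w => ¬ (s ∈ A w ↔ s ∈ W)).card : ℝ) ≤ 144 * (T : ℝ) ^ 2 * M := by
    have := stepB.trans (mul_le_mul_of_nonneg_left stepC (Nat.cast_nonneg _))
    nlinarith
  unfold flips
  exact_mod_cast hfin

/-- **Quasi-polynomially many flips.** If every string flipped by at least two candidates is a
code of length `> θ`, valued canonically in `W` and with the promise gap in the `A w`, then a
string of length `< 2ʲ` is flipped by at most `(144 · 4ʲ)ʲ` candidates (a code queries only
strings of less than half its length, and has fewer oracle gates than half its length).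
[cite: BennettBernsteinBrassardVazirani1997, Cor. 3.4] [cite: FortnowRogers1999JCSS, Thm. 4.3 and proof of Thm. 4.2 (arXiv numbering)] -/
theorem flips_le_pow (θ : ℕ)
    (hbig : ∀ u : List Bool, 2 ≤ flips W A Cand u →
      ∃ (x : List Bool) (m : ℕ) (C : QCircuit cliffordT (x.length + m)), u = ccode x m C ∧ θ < u.length)
    (hW : ∀ (x : List Bool) (m : ℕ) (C : QCircuit cliffordT (x.length + m)), θ < (ccode x m C).length →
      (ccode x m C ∈ W ↔ (1 / 2 : ℝ) ≤ C.acceptProb W x.get))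
    (hA : ∀ w ∈ Cand, ∀ (x : List Bool) (m : ℕ) (C : QCircuit cliffordT (x.length + m)),
      θ < (ccode x m C).length → (ccode x m C ∈ A w ↔
        (2 / 3 : ℝ) ≤ C.acceptProb (A w) x.get ∨ ((1 / 3 : ℝ) < C.acceptProb (A w) x.get ∧ ccode x m C ∈ W))) :
    ∀ (j : ℕ) (u : List Bool), u.length < 2 ^ j → flips W A Cand u ≤ (144 * 4 ^ j) ^ j := by
  intro j
  induction j with
  | zero =>
    intro u hu
    have hu0 : u = [] := List.eq_nil_of_length_eq_zero (by omega)
    by_contra h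
    have h2 : 2 ≤ flips W A Cand u := by
      simp only [pow_zero] at h
      omega
    obtain ⟨x, m, C, hux, -⟩ := hbig u h2
    have := congrArg List.length hux
    rw [hu0] at this
    simp [ccode] at this
  | succ j ih =>
    intro u hu
    by_cases h2 : flips W A Cand u < 2
    · exact le_trans (by omega) (Nat.one_le_pow _ _ (by positivity))
    obtain ⟨x, m, C, rfl, hθ⟩ := hbig u (not_lt.1 h2)
    have hwires := two_mul_wires_add_le x m C
    have hT := two_mul_oracleQueries_lt x m C
    have hM : ∀ u : List Bool, u.length < x.length + m → flips W A Cand u ≤ (144 * 4 ^ j) ^ j :=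
      fun u hu' => ih u (by omega)
    refine (flips_ccode_le W A Cand x m C (hW x m C hθ) (fun w hw => hA w hw x m C hθ) hM).trans ?_
    have hT' : C.oracleQueries < 2 ^ j := by omega
    calc 144 * C.oracleQueries ^ 2 * (144 * 4 ^ j) ^ j
        ≤ 144 * (2 ^ j) ^ 2 * (144 * 4 ^ j) ^ j := by gcongr
      _ = (144 * 4 ^ j) ^ (j + 1) := by
          have h4 : (2 ^ j) ^ 2 = 4 ^ j := by rw [← pow_mul, mul_comm, pow_mul]; norm_num
          rw [h4]
          ring
      _ ≤ (144 * 4 ^ (j + 1)) ^ (j + 1) := by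
          gcongr
          · norm_num
          · exact Nat.le_succ j

end Flips

end FRO

end Literature.Computability.QuantumComplexity

end
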